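import Mathlib
import Literature.Geometry.Riemannian.AubinYamabeSphereSobolev
import HarnessLib

/-!
# Stub `stub_sobolevFourR4` of line `zero-mode-floor-dilute-gas`
(crux `Summit.QuantumFields.QCD.Theses.NestedDissectionSea.EarlyCrosserLaw`, item stmt-QuantumFields-13995)

S2a — the **sharp `L⁴`-Sobolev inequality on `ℝ⁴`** (Aubin 1976, Talenti 1976): for smooth compactly
supported `f : ℝ⁴ → ℝ`, `(∫ f⁴)^{1/2} ≤ (√6/(8π)) ∫ ‖df‖²`.  The skeleton had filed it as a
Literature-fact-grade stub; it is in fact already PROVED in the tree, in the form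
`8√6 π (∫ φ⁴)^{1/2} ≤ 6 ∫ ‖∇φ‖²` (`Literature.Geometry.Riemannian.sharp_sobolev_euclidean_four`,
mass transport with the Knothe map, `AubinYamabeSphereSobolev.lean`).  This file is the two-line
transfer: `‖∇φ(x)‖ = ‖dφ(x)‖` (Riesz isometry) and `6/(8√6 π) = √6/(8π)`.
-/

noncomputable section

open scoped BigOperators ContDiff
open MeasureTheory

namespace Summit.QuantumFields.QCD.Cruxes.EarlyCrosserLaw.ZeroModeFloorDiluteGas

/-- The gradient and the differential have the same norm (the Riesz map is an isometry). -/
theorem norm_gradient_eq_norm_fderiv (f : EuclideanSpace ℝ (Fin 4) → ℝ) (x : EuclideanSpace ℝ (Fin 4)) :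
    ‖gradient f x‖ = ‖fderiv ℝ f x‖ := by
  rw [gradient]
  exact (InnerProductSpace.toDual ℝ (EuclideanSpace ℝ (Fin 4))).symm.norm_map _

/-- **S2a `stub_sobolevFourR4` — the sharp `L⁴`-Sobolev inequality on `ℝ⁴`** (registered stub of line
`zero-mode-floor-dilute-gas`; Aubin 1976 / Talenti 1976), from the tree's
`Literature.Geometry.Riemannian.sharp_sobolev_euclidean_four`. -/
theorem stub_sobolevFourR4 :
    ∀ f : EuclideanSpace ℝ (Fin 4) → ℝ, ContDiff ℝ ((⊤ : ℕ∞) : WithTop ℕ∞) f → HasCompactSupport f → Real.sqrt (∫ x, f x ^ 4) ≤ (Real.sqrt 6 / (8 * Real.pi)) * ∫ x, ‖fderiv ℝ f x‖ ^ 2 := by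
  intro f hf hfs
  have h := Literature.Geometry.Riemannian.sharp_sobolev_euclidean_four f hf hfs
  simp only [norm_gradient_eq_norm_fderiv] at h
  have hπ : 0 < Real.pi := Real.pi_pos
  have h6 : 0 < Real.sqrt 6 := Real.sqrt_pos.2 (by norm_num)
  have hsq : Real.sqrt 6 * Real.sqrt 6 = 6 := Real.mul_self_sqrt (by norm_num)
  have key : 8 * Real.pi * Real.sqrt (∫ x, f x ^ 4) ≤ Real.sqrt 6 * ∫ x, ‖fderiv ℝ f x‖ ^ 2 := by
    have h' := mul_le_mul_of_nonneg_left h h6.le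
    have e1 : Real.sqrt 6 * (8 * Real.sqrt 6 * Real.pi * Real.sqrt (∫ x, f x ^ 4))
        = 6 * (8 * Real.pi * Real.sqrt (∫ x, f x ^ 4)) := by
      rw [show Real.sqrt 6 * (8 * Real.sqrt 6 * Real.pi * Real.sqrt (∫ x, f x ^ 4))
          = (Real.sqrt 6 * Real.sqrt 6) * (8 * Real.pi * Real.sqrt (∫ x, f x ^ 4)) by ring, hsq]
    have e2 : Real.sqrt 6 * (6 * ∫ x, ‖fderiv ℝ f x‖ ^ 2) = 6 * (Real.sqrt 6 * ∫ x, ‖fderiv ℝ f x‖ ^ 2) := by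
      ring
    rw [e1, e2] at h'
    exact le_of_mul_le_mul_left h' (by norm_num)
  rw [div_mul_eq_mul_div, le_div_iff₀ (by positivity)]
  linarith [key]

end Summit.QuantumFields.QCD.Cruxes.EarlyCrosserLaw.ZeroModeFloorDiluteGas

end
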